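import Summits.KontsevichZagierPeriods.KontsevichZagierPeriods.Theses.SymplecticScissors
import Literature.ModelTheory.ExponentialFields.CylindricalDecomposition
import Literature.NumberTheory.Transcendental.SemialgebraicLineDeriv
import Literature.NumberTheory.Transcendental.KZCalculusProofs
import Literature.NumberTheory.Transcendental.SemialgebraicDerivativeProofs

/-!
# Signed sweep of the triangle, helper VI: strips and cells of the line

Helper file for the stub `stub_signedSweep` of the line `twist-restoring-shear` (crux
`PlanarCompiler`, route `SymplecticScissors`). Generic bookkeeping for the sweep:

* sorting a finite set of breakpoints in `[0, 1]` containing `0, 1` into a strictly increasing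
  enumeration `x₀ = 0 < x₁ < ⋯ < x_k = 1` whose open strips avoid the breakpoints and, with them,
  cover `[0, 1]`;
* the cells of a cylindrical decomposition of the line: each is a point `{c}` or contains, with a
  point, every point not separated from it by a point cell;
* monotonicity of graphs and bands in the base set; half-lines and strips with `ℚ`-semialgebraic
  end points; semialgebraicity of a section extended by zero.
-/

noncomputable section

open MeasureTheory Set Filter Topology
open Literature.NumberTheory.Transcendental Literature.ModelTheory.ExponentialFields

namespace Summit.KontsevichZagierPeriods.SymplecticScissors.PlanarCompilerProof

/-! ### Sorting the breakpoints -/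

/-- **Sorted breakpoints.** A finite set `B ⊆ [0, 1]` containing `0` and `1` is enumerated by a
strictly increasing `x : Fin (k + 1) → ℝ` with `x 0 = 0`, `x k = 1`; the open strips
`(x_s, x_{s+1})` contain no point of `B`, and every point of `[0, 1]` is a breakpoint or lies in a
strip. [folklore] -/
theorem stub_signedSweep_sortedStrips :
    ∀ (B : Finset ℝ), (0 : ℝ) ∈ B → (1 : ℝ) ∈ B → (∀ b ∈ B, 0 ≤ b ∧ b ≤ 1) →
    ∃ (k : ℕ) (x : Fin (k + 1) → ℝ), StrictMono x ∧ x 0 = 0 ∧ x (Fin.last k) = 1 ∧ (∀ i, x i ∈ B) ∧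
      (∀ b ∈ B, ∃ i, x i = b) ∧
      (∀ s : Fin k, ∀ b ∈ B, b ∉ Ioo (x (Fin.castSucc s)) (x (Fin.succ s))) ∧
      ∀ t ∈ Icc (0 : ℝ) 1, (∃ i, x i = t) ∨ ∃ s : Fin k, t ∈ Ioo (x (Fin.castSucc s)) (x (Fin.succ s)) := by
  intro B h0 h1 hB
  classical
  have hcard : 0 < B.card := Finset.card_pos.2 ⟨0, h0⟩
  set k := B.card - 1 with hk
  have hBk : B.card = k + 1 := by omega
  set x : Fin (k + 1) → ℝ := fun i => B.orderEmbOfFin hBk i with hx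
  have hxmono : StrictMono x := fun i j hij => (B.orderEmbOfFin hBk).strictMono hij
  have hxmem : ∀ i, x i ∈ B := fun i => Finset.orderEmbOfFin_mem B hBk i
  have hxsurj : ∀ b ∈ B, ∃ i, x i = b := by
    intro b hb
    have : b ∈ Set.range (B.orderEmbOfFin hBk) := by rw [Finset.range_orderEmbOfFin]; exact hb
    obtain ⟨i, hi⟩ := this
    exact ⟨i, hi⟩
  have hx0 : x 0 = 0 := by
    have h := Finset.orderEmbOfFin_zero hBk (Nat.succ_pos k)
    simp only [Fin.mk_zero] at h
    show B.orderEmbOfFin hBk 0 = 0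
    rw [h]
    exact le_antisymm (Finset.min'_le B 0 h0) (Finset.le_min' B _ 0 fun y hy => (hB y hy).1)
  have hxl : x (Fin.last k) = 1 := by
    have h := Finset.orderEmbOfFin_last hBk (Nat.succ_pos k)
    have hlast : (⟨k + 1 - 1, Nat.sub_lt (Nat.succ_pos k) Nat.one_pos⟩ : Fin (k + 1)) = Fin.last k :=
      Fin.ext (by simp)
    rw [hlast] at h
    show B.orderEmbOfFin hBk (Fin.last k) = 1
    rw [h]
    exact le_antisymm (Finset.max'_le B _ 1 fun y hy => (hB y hy).2) (Finset.le_max' B 1 h1)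
  have hstrip : ∀ s : Fin k, ∀ b ∈ B, b ∉ Ioo (x (Fin.castSucc s)) (x (Fin.succ s)) := by
    intro s b hb ⟨hb1, hb2⟩
    obtain ⟨i, rfl⟩ := hxsurj b hb
    have h1' : Fin.castSucc s < i := hxmono.lt_iff_lt.1 hb1
    have h2' : i < Fin.succ s := hxmono.lt_iff_lt.1 hb2
    rw [Fin.lt_def] at h1' h2'
    simp at h1' h2'
    omega
  refine ⟨k, x, hxmono, hx0, hxl, hxmem, hxsurj, hstrip, fun t ht => ?_⟩
  by_cases htB : t ∈ B
  · exact Or.inl (hxsurj t htB)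
  · right
    have ht0 : 0 < t := lt_of_le_of_ne ht.1 fun h => htB (h ▸ h0)
    have ht1 : t < 1 := lt_of_le_of_ne ht.2 fun h => htB (h ▸ h1)
    set I : Finset (Fin (k + 1)) := Finset.univ.filter fun i => x i < t with hI
    have hIne : I.Nonempty := ⟨0, by simp [hI, hx0, ht0]⟩
    set i₀ := I.max' hIne with hi₀
    have hi₀I : i₀ ∈ I := Finset.max'_mem I hIne
    have hi₀t : x i₀ < t := (Finset.mem_filter.1 hi₀I).2
    have hne : i₀ ≠ Fin.last k := fun h => by rw [h, hxl] at hi₀t; linarith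
    set s := i₀.castPred hne with hs
    have hcs : Fin.castSucc s = i₀ := Fin.castSucc_castPred i₀ hne
    refine ⟨s, ?_, ?_⟩
    · rw [hcs]; exact hi₀t
    · rcases lt_trichotomy t (x (Fin.succ s)) with h | h | h
      · exact h
      · exact absurd (h ▸ hxmem _) htB
      · have hmem : Fin.succ s ∈ I := Finset.mem_filter.2 ⟨Finset.mem_univ _, h⟩
        have hle : Fin.succ s ≤ i₀ := Finset.le_max' I _ hmem
        rw [← hcs] at hle
        exact absurd hle (not_le.2 Fin.castSucc_lt_succ)

/-! ### Cells of a cylindrical decomposition of the line -/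

/-- **Cells of the line.** A cell of a cylindrical decomposition of `ℝ¹` is either a point cell
`{z | z 0 = c}`, or it contains, together with a point `z`, every `w` such that no point cell
`{c}` of the decomposition has `c` between `z 0` and `w 0`. [cite: BasuPollackRoy2006, Def. 5.1] -/
theorem level_one_cell {𝒮 : Finset (Set (Fin 1 → ℝ))} (h : IsCylindricalDecomposition ℚ 1 𝒮)
    {S : Set (Fin 1 → ℝ)} (hS : S ∈ 𝒮) :
    (∃ c : ℝ, S = {z : Fin 1 → ℝ | z 0 = c}) ∨
      ∀ z ∈ S, ∀ w : Fin 1 → ℝ,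
        (∀ c : ℝ, {z : Fin 1 → ℝ | z 0 = c} ∈ 𝒮 → c ∉ uIcc (z 0) (w 0)) → w ∈ S := by
  obtain ⟨-, -, 𝒮₀, h𝒮₀, l, ξ, -, -, -, hmem⟩ := h
  have h𝒮₀' : 𝒮₀ = {univ} := isCylindricalDecomposition_zero.1 h𝒮₀
  subst h𝒮₀'
  obtain ⟨S₀, hS₀, hS'⟩ := (hmem S).1 hS
  rw [Finset.mem_singleton] at hS₀
  subst hS₀
  set e₀ : Fin 0 → ℝ := Fin.elim0 with he₀
  have hinit : ∀ z : Fin 1 → ℝ, Fin.init z = e₀ := fun z => Subsingleton.elim _ _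
  -- the point cells
  have hgraph : ∀ j : Fin (l univ), graphOver univ (ξ univ j) = {z : Fin 1 → ℝ | z 0 = ξ univ j e₀} := by
    intro j
    ext z
    rw [mem_graphOver_iff, hinit z]
    simp only [mem_univ, true_and, mem_setOf_eq]
    rfl
  have hpt : ∀ j : Fin (l univ), {z : Fin 1 → ℝ | z 0 = ξ univ j e₀} ∈ 𝒮 := fun j => by
    rw [← hgraph j]
    exact (hmem _).2 ⟨univ, Finset.mem_singleton_self _, Or.inl ⟨j, rfl⟩⟩
  rcases hS' with ⟨j, rfl⟩ | ⟨j, rfl⟩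
  · exact Or.inl ⟨ξ univ j e₀, hgraph j⟩
  · right
    intro z hz w hw
    rw [mem_bandOver_iff, hinit] at hz ⊢
    refine ⟨mem_univ _, ?_, ?_⟩
    · by_cases h0 : j = 0
      · rw [h0, bandLower_zero]; exact EReal.bot_lt_coe _
      · have hl := hz.2.1
        rw [bandLower_of_ne_zero _ j h0, EReal.coe_lt_coe_iff] at hl ⊢
        by_contra hle
        rw [not_lt] at hle
        refine hw _ (hpt (j.pred h0)) (mem_uIcc.2 (Or.inr ⟨hle, hl.le⟩))
    · by_cases h1 : j = Fin.last (l univ)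
      · rw [h1, bandUpper_last]; exact EReal.coe_lt_top _
      · have hu := hz.2.2
        rw [bandUpper_of_ne_last _ j h1, EReal.coe_lt_coe_iff] at hu ⊢
        by_contra hle
        rw [not_lt] at hle
        exact hw _ (hpt (j.castPred h1)) (mem_uIcc.2 (Or.inl ⟨hu.le, hle⟩))

/-- The point cells of a cylindrical decomposition of the line form a finite set of reals.
[folklore] -/
theorem finite_pointCells (𝒮 : Finset (Set (Fin 1 → ℝ))) :
    {c : ℝ | {z : Fin 1 → ℝ | z 0 = c} ∈ 𝒮}.Finite := by
  refine Set.Finite.preimage (f := fun c : ℝ => {z : Fin 1 → ℝ | z 0 = c}) ?_ 𝒮.finite_toSet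
  intro a _ b _ hab
  have hab' : {z : Fin 1 → ℝ | z 0 = a} = {z : Fin 1 → ℝ | z 0 = b} := hab
  have : (fun _ : Fin 1 => a) ∈ {z : Fin 1 → ℝ | z 0 = b} := by rw [← hab']; rfl
  exact this

/-- **A strip without point cells lies in one cell.** If the open strip `(u, v)` contains no point
cell of a cylindrical decomposition of the line, the whole strip lies in a single cell.
[folklore] -/
theorem exists_cell_strip_subset {𝒮 : Finset (Set (Fin 1 → ℝ))} (h : IsCylindricalDecomposition ℚ 1 𝒮)
    {u v : ℝ} (huv : u < v) (hno : ∀ c : ℝ, {z : Fin 1 → ℝ | z 0 = c} ∈ 𝒮 → c ∉ Ioo u v) :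
    ∃ S ∈ 𝒮, {z : Fin 1 → ℝ | z 0 ∈ Ioo u v} ⊆ S := by
  set z₀ : Fin 1 → ℝ := fun _ => (u + v) / 2 with hz₀
  have hz₀I : z₀ 0 ∈ Ioo u v := ⟨by simp [hz₀]; linarith, by simp [hz₀]; linarith⟩
  obtain ⟨S, ⟨hS, hz₀S⟩, -⟩ := h.isPartition.2 z₀
  refine ⟨S, hS, fun w hw => ?_⟩
  rcases level_one_cell h hS with ⟨c, rfl⟩ | hext
  · have hc : z₀ 0 = c := hz₀S
    exact absurd (hc ▸ hz₀I) (hno c hS)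
  · refine hext z₀ hz₀S w fun c hc hcI => hno c hc ?_
    have hw' : w 0 ∈ Ioo u v := hw
    rcases mem_uIcc.1 hcI with ⟨h1, h2⟩ | ⟨h1, h2⟩
    · exact ⟨hz₀I.1.trans_le h1, h2.trans_lt hw'.2⟩
    · exact ⟨hw'.1.trans_le h1, h2.trans_lt hz₀I.2⟩

/-! ### Small set-theoretic facts on graphs and bands -/

/-- Bands are monotone in the base set. [folklore] -/
theorem bandOver_mono {m l : ℕ} {S S' : Set (Fin m → ℝ)} (h : S' ⊆ S) (ξ : Fin l → (Fin m → ℝ) → ℝ)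
    (j : Fin (l + 1)) : bandOver S' ξ j ⊆ bandOver S ξ j :=
  fun _ hz => ⟨h hz.1, hz.2⟩

/-- Graphs are monotone in the base set. [folklore] -/
theorem graphOver_mono {m : ℕ} {S S' : Set (Fin m → ℝ)} (h : S' ⊆ S) (f : (Fin m → ℝ) → ℝ) :
    graphOver S' f ⊆ graphOver S f :=
  fun _ hz => ⟨h hz.1, hz.2⟩

/-- Adaptedness passes to subsets of a cell. [folklore] -/
theorem subset_or_disjoint_of_subset {α : Type*} {C D X : Set α} (hCD : C ⊆ D)
    (h : D ⊆ X ∨ Disjoint D X) : C ⊆ X ∨ Disjoint C X := by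
  rcases h with h | h
  · exact Or.inl (hCD.trans h)
  · exact Or.inr (h.mono_left hCD)

/-! ### Semialgebraic half-lines, strips and extensions by zero -/

/-- A half-line `{c < t}` bounded by a `ℚ`-semialgebraic point `{c}` is `ℚ`-semialgebraic
(`∃ s, s = c ∧ s < t`, Tarski–Seidenberg). [folklore] -/
theorem isSemialgebraic_Ioi_of_point {c : ℝ} (hc : IsSemialgebraic ℚ {z : Fin 1 → ℝ | z 0 = c}) :
    IsSemialgebraic ℚ {z : Fin 1 → ℝ | c < z 0} := by
  have key : IsSemialgebraic ℚ {z : Fin 1 → ℝ | ∃ s : ℝ, s = c ∧ s < z 0} := by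
    refine SemialgebraicDerivative.sa_exists ?_
    exact SemialgebraicDerivative.sa_and
      (SemialgebraicDerivative.sa_reindex (P := fun z : Fin 1 → ℝ => z 0 = c) hc (fun _ => 1))
      (SemialgebraicDerivative.sa_lt 1 0)
  convert key using 1
  ext z
  simp only [mem_setOf_eq]
  exact ⟨fun h => ⟨c, rfl, h⟩, fun ⟨s, hs, h⟩ => hs ▸ h⟩

/-- A half-line `{t < c}` bounded by a `ℚ`-semialgebraic point `{c}` is `ℚ`-semialgebraic.
[folklore] -/
theorem isSemialgebraic_Iio_of_point {c : ℝ} (hc : IsSemialgebraic ℚ {z : Fin 1 → ℝ | z 0 = c}) :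
    IsSemialgebraic ℚ {z : Fin 1 → ℝ | z 0 < c} := by
  have key : IsSemialgebraic ℚ {z : Fin 1 → ℝ | ∃ s : ℝ, s = c ∧ z 0 < s} := by
    refine SemialgebraicDerivative.sa_exists ?_
    exact SemialgebraicDerivative.sa_and
      (SemialgebraicDerivative.sa_reindex (P := fun z : Fin 1 → ℝ => z 0 = c) hc (fun _ => 1))
      (SemialgebraicDerivative.sa_lt 0 1)
  convert key using 1
  ext z
  simp only [mem_setOf_eq]
  exact ⟨fun h => ⟨c, rfl, h⟩, fun ⟨s, hs, h⟩ => hs ▸ h⟩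

/-- An open strip of the line with `ℚ`-semialgebraic end points is `ℚ`-semialgebraic. [folklore] -/
theorem isSemialgebraic_strip_of_points {u v : ℝ} (hu : IsSemialgebraic ℚ {z : Fin 1 → ℝ | z 0 = u})
    (hv : IsSemialgebraic ℚ {z : Fin 1 → ℝ | z 0 = v}) :
    IsSemialgebraic ℚ {z : Fin 1 → ℝ | z 0 ∈ Ioo u v} := by
  convert (isSemialgebraic_Ioi_of_point hu).inter (isSemialgebraic_Iio_of_point hv) using 1
  ext z
  simp only [mem_setOf_eq, mem_Ioo, mem_inter_iff]

/-- The points `0` and `1` of the line are `ℚ`-semialgebraic. [folklore] -/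
theorem isSemialgebraic_point_zero_one :
    IsSemialgebraic ℚ {z : Fin 1 → ℝ | z 0 = 0} ∧ IsSemialgebraic ℚ {z : Fin 1 → ℝ | z 0 = 1} := by
  constructor
  · convert isSemialgebraic_setOf_eval_eq_zero (k := ℚ) (R := ℝ) (ι := Fin 1) (MvPolynomial.X 0) using 1
    ext z; simp
  · convert isSemialgebraic_setOf_eval_eq_zero (k := ℚ) (R := ℝ) (ι := Fin 1)
      (MvPolynomial.X 0 - MvPolynomial.C 1) using 1
    ext z; simp [sub_eq_zero]

/-- **Extension by zero.** For `g` `ℚ`-semialgebraic on a `ℚ`-semialgebraic `S ⊆ ℝ¹`, the real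
function `t ↦ g(t)` on `S`, `0` off `S`, has `ℚ`-semialgebraic graph over the whole line (gluing
on `S` and its complement). [folklore] -/
theorem isSemialgebraicFunOn_extendByZero {S : Set (Fin 1 → ℝ)} [DecidablePred (· ∈ S)]
    (hS : IsSemialgebraic ℚ S) {g : (Fin 1 → ℝ) → ℝ} (hg : IsSemialgebraicFunOn ℚ S g) :
    IsSemialgebraicFunOn ℚ (univ : Set (Fin 1 → ℝ))
      (fun z => (fun t : ℝ => if ((fun _ : Fin 1 => t) : Fin 1 → ℝ) ∈ S then g (fun _ => t) else 0) (z 0)) := by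
  have hself : ∀ z : Fin 1 → ℝ, (fun _ : Fin 1 => z 0) = z := fun z =>
    funext fun i => by rw [Subsingleton.elim i 0]
  have h2 : IsSemialgebraicFunOn ℚ Sᶜ (fun _ => ((0 : ℚ) : ℝ)) :=
    isSemialgebraicFunOn_const_ratCast hS.compl 0
  have hU := IsSemialgebraicFunOn.union (F := fun z => if z ∈ S then g z else 0) hg h2
    (fun z hz => by simp [hz]) (fun z hz => by simp [Set.notMem_of_mem_compl hz])
  rw [Set.union_compl_self] at hU
  refine hU.congr fun z _ => ?_
  simp only [hself z]

end Summit.KontsevichZagierPeriods.SymplecticScissors.PlanarCompilerProof
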